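import Summits.QuantumFields.YangMills.Theorems.LangevinControlUVOSLegsFromFemtoAndGapStubCollar6
import Summits.QuantumFields.YangMills.Theorems.LangevinControlUVOSLegsFromFemtoAndGapStubLowerCube
import Literature.Analysis.FunctionSpaces.WeakCompactnessL1Proofs
import HarnessLib

/-!
# Crux `NT` (stmt-QuantumFields-19353), engine stub `stub_fcp6`: the femto boundary laws only need LARGE depth

Helper file (`--supports stmt-QuantumFields-19353`) of the fleet lead prover of crux `NT` (unit `ym-spine-19353-p1`);
an unconditional layer on the ENGINE side of the registered stub `stub_fcp6 : Statement.stub_fcp6`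
(`TwoPointPinned → Skewness → FBL6 ∧ FC2 ∧ FC3`).

The boundary laws `FBL6 G r a` / `FBL G r a` (`Theorems/LangevinControlUVOSLegsFromFemtoAndGapDefs.lean`) ask, on
every femto cube and for EVERY exterior, `|kerE (plane q x) − p q β| ≤ C₁ / depth⁴` at every site of depth `≥ 2`.
Any engine (multi-scale perturbation theory in a background field) produces such a law only from some depth `D₀` on,
where its interior expansion is clean.  This file proves that this is enough: a boundary law at depths `≥ D` (any
`D`, any reference values `p`, any sign of `C₁`) implies the registered `FBL6` / `FBL`, with the reference values
CLIPPED to the range `[−M, M]` of the observable (`M` from the tree's `exists_abs_plane_le` / `exists_abs_dens_le`)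
and the constant `max C₁ 0 + 2 M D⁴`: at depth `≥ D` clipping a real number to an interval containing the kernel
mean can only decrease the distance to it (`abs_sub_clip_le`), and at depth `2 ≤ d < D` the trivial bound
`|kerE − p'| ≤ 2M ≤ 2 M D⁴ / d⁴` takes over (the kernel `ymSpecification` is a probability measure,
`isProbabilityMeasure_ymSpecification`).

* `abs_sub_clip_le` — `|k| ≤ M → |k − clip_M p| ≤ |k − p|` (`clip_M p = max (−M) (min M p)`; its range bound is the
  tree's `Literature.Analysis.FunctionSpaces.abs_max_neg_min_le`);
* `abs_kerE_le` — `(∀ U, |F U| ≤ M) → |kerE G r β c b η F| ≤ M` (no measurability needed);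
* `fbl6_of_largeDepth`, `fbl_of_largeDepth` — the reductions.
-/

set_option autoImplicit false

noncomputable section

open MeasureTheory Filter Topology
open Literature.MathematicalPhysics.QuantumFieldTheory Literature.MathematicalPhysics.QuantumLattice
open Summit.QuantumFields.YangMills.Cruxes.OSLegsFromFemtoAndGap.DlrCollarTransfer
open Summit.QuantumFields.YangMills.Cruxes.OSLegsFromFemtoAndGap.DlrCollarTransfer.StubLower (exists_abs_dens_le)
open Literature.Analysis.FunctionSpaces (abs_max_neg_min_le)

namespace Summit.QuantumFields.YangMills.Cruxes.NT.BoundaryLaw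

/-! ## §1 Clipping a reference value to the range of the observable -/

/-- Clipping `p` to `[−M, M]` does not increase the distance to any `k ∈ [−M, M]`. [folklore] -/
theorem abs_sub_clip_le {k M p : ℝ} (hk : |k| ≤ M) : |k - max (-M) (min M p)| ≤ |k - p| := by
  obtain ⟨hk₁, hk₂⟩ := abs_le.1 hk
  rcases le_total p M with hpM | hMp
  · rw [min_eq_right hpM]
    rcases le_total (-M) p with hMp' | hpM'
    · rw [max_eq_right hMp']
    · rw [max_eq_left hpM', abs_le]
      have h1 : p ≤ k := hpM'.trans hk₁
      constructor
      · linarith [abs_nonneg (k - p)]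
      · rw [abs_of_nonneg (sub_nonneg.2 h1)]
        linarith
  · rw [min_eq_left hMp, max_eq_right (by linarith [hk₁.trans hk₂] : -M ≤ M), abs_le]
    have h1 : k ≤ p := hk₂.trans hMp
    constructor
    · rw [abs_of_nonpos (sub_nonpos.2 h1)]
      linarith
    · linarith [abs_nonneg (k - p)]

/-! ## §2 Kernel means of bounded continuous observables are bounded -/

section Kernel

variable (G : Type) [Group G] [TopologicalSpace G] [IsTopologicalGroup G] [CompactSpace G]
  [MeasurableSpace G] [BorelSpace G] (r : LatticeRep G)

/-- **A priori bound on cube-kernel means.**  The lattice Yang–Mills kernel of a cube with any exterior is a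
probability measure (tree `isProbabilityMeasure_ymSpecification`), so the kernel mean of an observable bounded by
`M` is bounded by `M` (Bochner integral: no measurability hypothesis is needed). [folklore] -/
theorem abs_kerE_le (β : ℝ) (c : Fin 4 → ℤ) (b : ℕ) (η : LGConfig 4 G) {F : LGConfig 4 G → ℝ} {M : ℝ}
    (hM : ∀ U, |F U| ≤ M) : |kerE G r β c b η F| ≤ M := by
  haveI : SecondCountableTopology G :=
    (r.continuous.isClosedEmbedding r.injective).isEmbedding.secondCountableTopology
  haveI := isProbabilityMeasure_ymSpecification r.ρ r.continuous β (cubeEdges c b) η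
  unfold kerE
  have h := norm_integral_le_of_norm_le_const (μ := ymSpecification (d := 4) r.ρ β (cubeEdges c b) η)
    (f := F) (C := M) (Eventually.of_forall fun U => by rw [Real.norm_eq_abs]; exact hM U)
  simpa [Real.norm_eq_abs] using h

/-! ## §3 The reductions -/

/-- **`FBL6` only needs large depth.**  If for some depth threshold `D` the plane-resolved boundary law holds at all
sites of depth `≥ D` of every femto cube (`b · a β ≤ ℓ₁`, `β ≥ β₁`), for every exterior and every orientation
`i < j`, with SOME reference values `p` and SOME constant `C₁`, then `FBL6 G r a` holds (reference values clipped to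
the range of the single-plane field, constant `max C₁ 0 + 2 M D⁴`). [folklore] -/
theorem fbl6_of_largeDepth (a : ℝ → ℝ) (D : ℕ)
    (h : ∃ (C₁ β₁ ℓ₁ : ℝ) (p : Fin 4 × Fin 4 → ℝ → ℝ), 0 < ℓ₁ ∧ ∀ β : ℝ, β₁ ≤ β →
      ∀ (c : Fin 4 → ℤ) (b : ℕ), (b : ℝ) * a β ≤ ℓ₁ → ∀ (η : LGConfig 4 G) (q : Fin 4 × Fin 4) (x : Fin 4 → ℤ),
        q.1 < q.2 → D ≤ depth c b x → |kerE G r β c b η (plane G r q x) - p q β| ≤ C₁ / (depth c b x : ℝ) ^ 4) :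
    FBL6 G r a := by
  obtain ⟨C₁, β₁, ℓ₁, p, hℓ₁, H⟩ := h
  obtain ⟨M, hM⟩ := exists_abs_plane_le (G := G) r
  have hM0 : 0 ≤ M := (abs_nonneg _).trans (hM (0, 1) 0 (fun _ => 1))
  refine ⟨max C₁ 0 + 2 * M * (D : ℝ) ^ 4, β₁, ℓ₁, fun q β => max (-M) (min M (p q β)), hℓ₁, by positivity, ?_⟩
  intro β hβ c b hb η q x hq hx
  have hker : |kerE G r β c b η (plane G r q x)| ≤ M :=
    abs_kerE_le G r β c b η (hM q x)
  have hd : (0 : ℝ) < (depth c b x : ℝ) := by exact_mod_cast (lt_of_lt_of_le (by norm_num) hx)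
  have hd4 : (0 : ℝ) < (depth c b x : ℝ) ^ 4 := by positivity
  rcases le_or_gt D (depth c b x) with hD | hD
  · -- large depth: clip, then use the hypothesis
    calc |kerE G r β c b η (plane G r q x) - max (-M) (min M (p q β))|
        ≤ |kerE G r β c b η (plane G r q x) - p q β| := abs_sub_clip_le hker
      _ ≤ C₁ / (depth c b x : ℝ) ^ 4 := H β hβ c b hb η q x hq hD
      _ ≤ (max C₁ 0 + 2 * M * (D : ℝ) ^ 4) / (depth c b x : ℝ) ^ 4 := by
          gcongr
          exact (le_max_left _ _).trans (le_add_of_nonneg_right (by positivity))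
  · -- small depth `2 ≤ d < D`: trivial bound `2M ≤ 2 M D⁴ / d⁴`
    have hdD' : (depth c b x : ℝ) ≤ (D : ℝ) := by exact_mod_cast hD.le
    have hdD : (depth c b x : ℝ) ^ 4 ≤ (D : ℝ) ^ 4 := pow_le_pow_left₀ hd.le hdD' 4
    calc |kerE G r β c b η (plane G r q x) - max (-M) (min M (p q β))|
        ≤ |kerE G r β c b η (plane G r q x)| + |max (-M) (min M (p q β))| := abs_sub _ _
      _ ≤ M + M := add_le_add hker (abs_max_neg_min_le hM0 _)
      _ = 2 * M * (depth c b x : ℝ) ^ 4 / (depth c b x : ℝ) ^ 4 := by field_simp; ring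
      _ ≤ (max C₁ 0 + 2 * M * (D : ℝ) ^ 4) / (depth c b x : ℝ) ^ 4 := by
          gcongr
          calc 2 * M * (depth c b x : ℝ) ^ 4 ≤ 2 * M * (D : ℝ) ^ 4 :=
                mul_le_mul_of_nonneg_left hdD (by positivity)
            _ ≤ max C₁ 0 + 2 * M * (D : ℝ) ^ 4 := le_add_of_nonneg_left (le_max_right _ _)

/-- **`FBL` only needs large depth** (the same reduction for the action density `dens`, range `M` from
`exists_abs_dens_le`). [folklore] -/
theorem fbl_of_largeDepth (a : ℝ → ℝ) (D : ℕ)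
    (h : ∃ (C₁ β₁ ℓ₁ : ℝ) (p : ℝ → ℝ), 0 < ℓ₁ ∧ ∀ β : ℝ, β₁ ≤ β →
      ∀ (c : Fin 4 → ℤ) (b : ℕ), (b : ℝ) * a β ≤ ℓ₁ → ∀ (η : LGConfig 4 G) (x : Fin 4 → ℤ),
        D ≤ depth c b x → |kerE G r β c b η (dens G r x) - p β| ≤ C₁ / (depth c b x : ℝ) ^ 4) :
    FBL G r a := by
  obtain ⟨C₁, β₁, ℓ₁, p, hℓ₁, H⟩ := h
  obtain ⟨M, hM0, hM⟩ := exists_abs_dens_le G r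
  refine ⟨max C₁ 0 + 2 * M * (D : ℝ) ^ 4, β₁, ℓ₁, fun β => max (-M) (min M (p β)), hℓ₁, by positivity, ?_⟩
  intro β hβ c b hb η x hx
  have hker : |kerE G r β c b η (dens G r x)| ≤ M :=
    abs_kerE_le G r β c b η (hM x)
  have hd : (0 : ℝ) < (depth c b x : ℝ) := by exact_mod_cast (lt_of_lt_of_le (by norm_num) hx)
  have hd4 : (0 : ℝ) < (depth c b x : ℝ) ^ 4 := by positivity
  rcases le_or_gt D (depth c b x) with hD | hD
  · calc |kerE G r β c b η (dens G r x) - max (-M) (min M (p β))|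
        ≤ |kerE G r β c b η (dens G r x) - p β| := abs_sub_clip_le hker
      _ ≤ C₁ / (depth c b x : ℝ) ^ 4 := H β hβ c b hb η x hD
      _ ≤ (max C₁ 0 + 2 * M * (D : ℝ) ^ 4) / (depth c b x : ℝ) ^ 4 := by
          gcongr
          exact (le_max_left _ _).trans (le_add_of_nonneg_right (by positivity))
  · have hdD' : (depth c b x : ℝ) ≤ (D : ℝ) := by exact_mod_cast hD.le
    have hdD : (depth c b x : ℝ) ^ 4 ≤ (D : ℝ) ^ 4 := pow_le_pow_left₀ hd.le hdD' 4
    calc |kerE G r β c b η (dens G r x) - max (-M) (min M (p β))|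
        ≤ |kerE G r β c b η (dens G r x)| + |max (-M) (min M (p β))| := abs_sub _ _
      _ ≤ M + M := add_le_add hker (abs_max_neg_min_le hM0 _)
      _ = 2 * M * (depth c b x : ℝ) ^ 4 / (depth c b x : ℝ) ^ 4 := by field_simp; ring
      _ ≤ (max C₁ 0 + 2 * M * (D : ℝ) ^ 4) / (depth c b x : ℝ) ^ 4 := by
          gcongr
          calc 2 * M * (depth c b x : ℝ) ^ 4 ≤ 2 * M * (D : ℝ) ^ 4 :=
                mul_le_mul_of_nonneg_left hdD (by positivity)
            _ ≤ max C₁ 0 + 2 * M * (D : ℝ) ^ 4 := le_add_of_nonneg_left (le_max_right _ _)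

end Kernel

end Summit.QuantumFields.YangMills.Cruxes.NT.BoundaryLaw

end
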